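import Literature.NumberTheory.EllipticCurves.LocalPointsFiniteIndexLattice
import HarnessLib

/-!
# Reading lemmas for `silvermanVII63_localLayerPoints_finiteIndex_zpLattice` (Silverman AEC VII Prop. 6.3 on the local layers):
# the generic unfolding and the `K = ℚ` shape (`e(p|p) f(p|p) = 1`)

Topic `NumberTheory/EllipticCurves`; namespace = path. A PROOFS file (theorems only: no definition, no named fact; D-0026):
reading lemmas of the named fact of `LocalPointsFiniteIndexLattice.lean` (LADDER-BSD D-0154 (2) INPUTS desk, director-bsd g15
TYPING REQUEST 2026-08-28T18:07Z; seat `bsd-inputs-honda-p1` g13). `rat` is the consumer's shape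
(`Sprung2012/ColemanMapJointCokernelProofs.lean`, hypothesis `hind`, `K = ℚ`, `E = ℚ_p`): a finite-index `ℤ_p`-lattice of rank
`[ℚ_{n,v} : ℚ_p] = (localLayerSubgroupOfEmb κ ι n).index` in `E(ℚ_{n,v})`. Everything is CONDITIONAL on the named fact
(hypothesis `h`); BSD is not proved by any of this.

References: [SilvermanAEC2009] VII Prop. 6.3, IV Thm. 6.4 (b); [Sprung2012] Lemma 2.3 (p. 1488).
-/

noncomputable section

open NumberField IsDedekindDomain

namespace Literature.NumberTheory.EllipticCurves

namespace silvermanVII63_localLayerPoints_finiteIndex_zpLattice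

/-- Reading the fact at a place `v ∣ p` of a number field `K`: the finite-index `ℤ_p`-lattice of rank
`[K_n·K_v : K_v]·e(v|p)f(v|p)` inside `E(K_n·K_v)`. [cite: SilvermanAEC2009, VII Prop. 6.3] -/
theorem exists_lattice (h : silvermanVII63_localLayerPoints_finiteIndex_zpLattice) {K : Type} [Field K] [NumberField K]
    {p : ℕ} [Fact p.Prime] (κ : ZpExtension K p) {v : HeightOneSpectrum (𝓞 K)} (hv : ((p : ℕ) : 𝓞 K) ∈ v.asIdeal)
    (ι : AlgebraicClosure K →ₐ[K] AlgebraicClosure (v.adicCompletion K)) (W : WeierstrassCurve K) [W.IsElliptic] (n : ℕ) :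
    ∃ H : AddSubgroup (localPoints W (v.adicCompletion K)),
      H ≤ Kobayashi2003.localLayerPointsOfEmb κ ι W n ∧
      (H.addSubgroupOf (Kobayashi2003.localLayerPointsOfEmb κ ι W n)).FiniteIndex ∧
      Nonempty (H ≃+ (Fin ((Kobayashi2003.localLayerSubgroupOfEmb κ ι n).index *
        (v.asIdeal.ramificationIdx ℤ * v.asIdeal.inertiaDeg ℤ)) → ℤ_[p])) :=
  h K p κ v hv ι W n

/-- `e(v|p) · f(v|p) = 1` for every finite place `v` of `ℚ` (fundamental identity `∑_{q ∣ p} e_q f_q = [𝓞 ℚ : ℤ] = 1`,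
Mathlib `Ideal.sum_ramification_inertia_eq_finrank` with `NumberField.RingOfIntegers.rank`; every term positive). Private
bookkeeping (the same computation is private in `Greenberg1999/EulerCharacteristic*MultiplicativeAnyPrime.lean`). [folklore] -/
private theorem ramificationIdx_mul_inertiaDeg_eq_one_rat (v : HeightOneSpectrum (𝓞 ℚ)) :
    v.asIdeal.ramificationIdx ℤ * v.asIdeal.inertiaDeg ℤ = 1 := by
  set P := v.asIdeal with hP
  haveI : P.IsPrime := v.isPrime
  set q : Ideal ℤ := P.under ℤ with hq
  haveI : P.LiesOver q := ⟨rfl⟩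
  have hmem : P ∈ q.primesOver (𝓞 ℚ) := ⟨v.isPrime, inferInstance⟩
  have hsum := Ideal.sum_ramification_inertia_eq_finrank q (𝓞 ℚ)
  rw [NumberField.RingOfIntegers.rank, Module.finrank_self] at hsum
  have hle := Finset.single_le_sum
    (f := fun r : q.primesOver (𝓞 ℚ) => r.1.ramificationIdx ℤ * r.1.inertiaDeg ℤ)
    (fun _ _ => Nat.zero_le _) (Finset.mem_univ ⟨P, hmem⟩)
  rw [hsum] at hle
  have hpos : 0 < P.ramificationIdx ℤ * P.inertiaDeg ℤ :=
    Nat.mul_pos (Ideal.ramificationIdx_pos P ℤ) (Ideal.inertiaDeg_pos P ℤ)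
  have hle' : P.ramificationIdx ℤ * P.inertiaDeg ℤ ≤ 1 := hle
  omega

/-- **The `K = ℚ` shape** (the consumer's: `W/ℚ`, `v ∋ p`, `E = ℚ_p`, any `ℤ_p`-extension `κ` of `ℚ`, any `ι`): `E(ℚ_{n,v})`
(`= localLayerPointsOfEmb κ ι W n`) contains a finite-index subgroup `H ≃+ ℤ_p^d` with `d = [ℚ_{n,v} : ℚ_p] =
(localLayerSubgroupOfEmb κ ι n).index` (`e(p|p) f(p|p) = 1`; for the cyclotomic `κ` that index is `pⁿ`, Summit-side
`index_localLayerSubgroupOfEmb_eq_pow`) — Sprung 2012 Lemma 2.3's rank clause «`Ê(𝔪_n)` free of rank `pⁿ`» up to the finite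
quotient `E/Ê`. [cite: SilvermanAEC2009, VII Prop. 6.3] [cite: Sprung2012, Lemma 2.3 (p. 1488)] -/
theorem rat (h : silvermanVII63_localLayerPoints_finiteIndex_zpLattice) {p : ℕ} [Fact p.Prime] (κ : ZpExtension ℚ p)
    {v : HeightOneSpectrum (𝓞 ℚ)} (hv : ((p : ℕ) : 𝓞 ℚ) ∈ v.asIdeal)
    (ι : AlgebraicClosure ℚ →ₐ[ℚ] AlgebraicClosure (v.adicCompletion ℚ)) (W : WeierstrassCurve ℚ) [W.IsElliptic] (n : ℕ) :
    ∃ H : AddSubgroup (localPoints W (v.adicCompletion ℚ)),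
      H ≤ Kobayashi2003.localLayerPointsOfEmb κ ι W n ∧
      (H.addSubgroupOf (Kobayashi2003.localLayerPointsOfEmb κ ι W n)).FiniteIndex ∧
      Nonempty (H ≃+ (Fin (Kobayashi2003.localLayerSubgroupOfEmb κ ι n).index → ℤ_[p])) := by
  have h' := h ℚ p κ v hv ι W n
  rwa [ramificationIdx_mul_inertiaDeg_eq_one_rat v, mul_one] at h'

end silvermanVII63_localLayerPoints_finiteIndex_zpLattice

end Literature.NumberTheory.EllipticCurves

end
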